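import Literature.NumberTheory.EllipticCurves.CuspFormLFunctionNewformFrickeProofs
import Literature.NumberTheory.EllipticCurves.Gamma1NewformFunctionalEquationProofs
import Literature.NumberTheory.EllipticCurves.LSeriesHeckeRecursionNonvanishingProofs
import Literature.NumberTheory.EllipticCurves.ModularityVersionAp
import Literature.NumberTheory.EllipticCurves.PeriodRationality
import HarnessLib

/-!
# Non-vanishing of the completed critical values of a newform strictly left of the centre

Theorems only (no definition, no named fact). For a newform `f ∈ S_k(Γ₀(N))` and an integer `n` with
`0 < n` and `2n + 2 < k`, the completed critical value `Λ(f, n) = ∫₀^∞ f(it) t^{n-1} dt`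
(`completedLValue f n`, `PeriodRationality.lean`) is NON-ZERO:

* `IsNewform0.cuspFormLSeries_ne_zero` — `L(f, s) ≠ 0` for `re s > k/2 + 1` (Hecke recursions
  `IsNewform0.cuspCoeff_prime_mul` + the sieve argument `LSeries_ne_zero_of_heckeRecursion`; classically the
  Euler product, Diamond–Shurman Thm. 5.9.2);
* `IsNewform0.completedCuspFormL_ne_zero` — hence `Λ_N(f, s) = N^{s/2}(2π)^{-s}Γ(s)L(f,s) ≠ 0` there;
* `completedLValue_eq_mellin` — `Λ(f, n)` is the Mellin transform of `t ↦ f(it)` at `s = n`;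
* `IsNewform0.completedLValue_ne_zero_of_two_mul_add_two_lt` — by Hecke's functional equation
  `Λ(s) = i^k ε(f) Λ(k − s)` (`IsNewform0.exists_functional_equation_holds`, `ε(f) = ±1`) for THE entire continuation
  `N^{s/2}·𝓜(f(i·))(s)` (`cpow_mul_mellin_imagAxis_mem_completedCuspFormLContinuations`, uniqueness
  `subsingleton_completedCuspFormLContinuations`), `Λ(f, n) ≠ 0` as soon as `k − n > k/2 + 1`.

The boundary case `2n + 2 = k` (absolute convergence at `re s = k/2 + 1`) needs Deligne's bound and is not treated.
Consumers: route TangentCone / crux `EdgeCap` (stmt-BirchSwinnertonDyer-17609): the reference ratios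
`Λ(g,s)/Λ(g,j)` of its conclusion have non-zero denominators for `2j + 2 < k` (skeleton vet 2026-08-17; stub
`stub_interpolant` of line `ratio_measure_strassmann`). References: Hecke 1936; Diamond–Shurman, GTM 228, Thms 5.9.2,
5.10.2; Jacquet–Shalika (trivial range).
-/

noncomputable section

open Complex CongruenceSubgroup
open scoped MatrixGroups ModularForm

namespace Literature.NumberTheory.EllipticCurves.ModularForms

variable {N : ℕ} [NeZero N] {k : ℤ}

/-- **`L(f, s) ≠ 0` in the half-plane of absolute convergence** for a newform `f ∈ S_k(Γ₀(N))`: the coefficients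
satisfy `a₁ = 1` and the Hecke recursions `a_{pn} = a_p a_n − 𝟙_N(p) p^{k−1} a_{n/p}` (`IsNewform0.cuspCoeff_prime_mul`),
so the sieve argument `LSeries_ne_zero_of_heckeRecursion` applies wherever `∑ aₙ n^{-s}` converges absolutely
(`re s > k/2 + 1`, `LSeriesSummable_cuspCoeff_gamma0`) (Diamond–Shurman Thm. 5.9.2). [cite: DiamondShurman2005, Thm. 5.9.2] -/
theorem IsNewform0.cuspFormLSeries_ne_zero {f : CuspForm (Gamma0 N) k} (hf : IsNewform0 f) {s : ℂ}
    (hs : (k : ℝ) / 2 + 1 < s.re) : cuspFormLSeries f s ≠ 0 := by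
  refine HeckeRecursionLSeries.LSeries_ne_zero_of_heckeRecursion (a := cuspCoeff f) hf.2.2 (fun p hp => ?_)
    (LSeriesSummable_cuspCoeff_gamma0 f hs)
  refine ⟨cuspCoeff f p, if p ∣ N then 0 else (p : ℂ) ^ (k - 1), fun n _ => ?_⟩
  rw [hf.cuspCoeff_prime_mul hp n]
  split_ifs <;> ring

/-- **`Λ_N(f, s) ≠ 0` for `re s > k/2 + 1` and `re s > 0`** (newform `f`): each factor of the raw product
`N^{s/2}(2π)^{-s}Γ(s)L(f,s)` is non-zero there. [cite: DiamondShurman2005, Thm. 5.9.2] -/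
theorem IsNewform0.completedCuspFormL_ne_zero {f : CuspForm (Gamma0 N) k} (hf : IsNewform0 f) {s : ℂ}
    (hs : (k : ℝ) / 2 + 1 < s.re) (hs₀ : 0 < s.re) : completedCuspFormL N f s ≠ 0 := by
  unfold completedCuspFormL
  have hN : (N : ℂ) ≠ 0 := by exact_mod_cast NeZero.ne N
  have hπ : (2 * Real.pi : ℂ) ≠ 0 := by
    have : (0 : ℝ) < 2 * Real.pi := by positivity
    exact_mod_cast this.ne'
  refine mul_ne_zero (mul_ne_zero (mul_ne_zero ?_ ?_) (Complex.Gamma_ne_zero_of_re_pos hs₀))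
    (hf.cuspFormLSeries_ne_zero hs)
  · rw [cpow_def_of_ne_zero hN]; exact exp_ne_zero _
  · rw [cpow_def_of_ne_zero hπ]; exact exp_ne_zero _

omit [NeZero N] in
/-- **`Λ(f, n)` is the Mellin transform of `t ↦ f(it)` at `s = n`** (`n ≥ 1`): the integrands
`t^{n-1} f(it)` (natural power, `completedLValue`) and `t^{s-1} • f(it)` (complex power, Mathlib `mellin`) agree on
`(0, ∞)`. [folklore] -/
theorem completedLValue_eq_mellin (f : CuspForm (Gamma0 N) k) {n : ℕ} (hn : 0 < n) :
    completedLValue f n =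
      mellin (fun t : ℝ ↦ (f : UpperHalfPlane → ℂ) (UpperHalfPlane.ofComplex (Complex.I * (t : ℂ)))) (n : ℂ) := by
  rw [completedLValue_def, mellin]
  refine MeasureTheory.setIntegral_congr_fun measurableSet_Ioi fun t _ => ?_
  simp only [smul_eq_mul]
  have hexp : ((n : ℂ) - 1) = ((n - 1 : ℕ) : ℂ) := by push_cast [Nat.cast_sub hn]; ring
  rw [hexp, cpow_natCast, mul_comm (Complex.I) (t : ℂ)]

/-- **T4 · non-vanishing of the completed critical values strictly left of the centre.** For a newform
`f ∈ S_k(Γ₀(N))` and `0 < n` with `2n + 2 < k`: `Λ(f, n) = ∫₀^∞ f(it) t^{n−1} dt ≠ 0`. Proof: `N^{s/2}𝓜(f(i·))(s)` is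
the (unique) entire continuation of `Λ_N(f,s)`; Hecke's functional equation `Λ(n) = i^k ε(f) Λ(k−n)` with `ε(f) = ±1`;
and `Λ(k−n) = Λ_N(f, k−n) ≠ 0` because `k − n > k/2 + 1` lies in the half-plane of absolute convergence
(`IsNewform0.completedCuspFormL_ne_zero`). (Diamond–Shurman Thms 5.9.2, 5.10.2; the boundary `2n+2 = k` would need
Deligne's bound.) [cite: DiamondShurman2005, Thm. 5.10.2] -/
theorem IsNewform0.completedLValue_ne_zero_of_two_mul_add_two_lt {f : CuspForm (Gamma0 N) k}
    (hf : IsNewform0 f) {n : ℕ} (hn : 0 < n) (h : 2 * (n : ℤ) + 2 < k) :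
    completedLValue f n ≠ 0 := by
  have hk : -2 ≤ k := by omega
  have hΛ := cpow_mul_mellin_imagAxis_mem_completedCuspFormLContinuations hk (strictWidthInfty_Gamma0 N) N f
  obtain ⟨Λ', hΛ', hFE⟩ := IsNewform0.exists_functional_equation_holds (N := N) (k := k) hf
  have heq := subsingleton_completedCuspFormLContinuations N f hΛ' hΛ
  have hε : frickeEigenvalue f = 1 ∨ frickeEigenvalue f = -1 :=
    IsNewform0.frickeEigenvalue_eq_one_or_eq_neg_one_holds (N := N) (k := k) hf
  -- the reflected point `k − n` lies in the half-plane of absolute convergence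
  have h' : 2 * (n : ℝ) + 2 < (k : ℝ) := by exact_mod_cast h
  have hre : (k : ℝ) / 2 + 1 < ((k : ℂ) - (n : ℂ)).re := by
    simp only [sub_re, intCast_re, natCast_re]
    linarith
  have hre₀ : 0 < ((k : ℂ) - (n : ℂ)).re := by
    have hn' : (0 : ℝ) ≤ n := by positivity
    simp only [sub_re, intCast_re, natCast_re]
    linarith
  have hval := hΛ.2 ((k : ℂ) - (n : ℂ)) hre
  have hne : completedCuspFormL N f ((k : ℂ) - (n : ℂ)) ≠ 0 := hf.completedCuspFormL_ne_zero hre hre₀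
  -- functional equation at `s = n`, for THE continuation
  have h1 := hFE (n : ℂ)
  rw [heq] at h1
  simp only [] at h1 hval
  -- `h1 : N^{n/2} · 𝓜(n) = i^k ε · (N^{(k-n)/2} · 𝓜(k-n))`, `hval : N^{(k-n)/2} · 𝓜(k-n) = Λ_N(f, k-n)`
  rw [hval] at h1
  have hΛn : (N : ℂ) ^ ((n : ℂ) / 2) *
      mellin (fun t : ℝ ↦ (f : UpperHalfPlane → ℂ) (UpperHalfPlane.ofComplex (Complex.I * (t : ℂ)))) (n : ℂ) ≠ 0 := by
    rw [h1]
    refine mul_ne_zero (mul_ne_zero (zpow_ne_zero _ I_ne_zero) ?_) hne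
    rcases hε with h' | h' <;> simp [h']
  rw [completedLValue_eq_mellin f hn]
  exact fun h0 => hΛn (by rw [h0, mul_zero])

end Literature.NumberTheory.EllipticCurves.ModularForms

end
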